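import Summits.NavierStokesRegularity.NavierStokesRegularity.Theorems.HeredityFromTwoT.Negative.HeredityFromTwoTFalseOfNoSwirlRungT
import Summits.NavierStokesRegularity.FluidComputer.PalasekTowerGermHostMechanismDoorAt
import Summits.NavierStokesRegularity.FluidComputer.PalasekTowerGermHostFreeRunStageAt
import Summits.NavierStokesRegularity.FluidComputer.PalasekTowerGermHostDilation
import Literature.Analysis.FluidPDE.SmallL3ClassicalSupBound

/-!
# The STERILE mechanism door at `tuned` from a STERILE small carrier — the crux-strategist's stub
# `stub_sterile_door_of_small_carrierT : SterileSmallCarrierT → SterileMechanismDoorT` of line `doormirror`, BY ITS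
# UNFOLDED TEXT (the door of record re-walked COAXIALLY; no computation)

Cell `ns-blowup`, seat `ns-blowup-ecbridge-3` (g12; D-0074 GROUP C «BRIDGE SUPPORT», lineage `host_preparation`).
Route `PalasekTowerBreakdown` (rev 19): crux stmt-NavierStokesRegularity-20303 `EpisodeBaseT`, pair 20304/20305; line
`Cruxes/EpisodeBaseT/Lines/doormirror.lean` (cstrat-19179 g3, v2): stubs T1′ `SterileDoorBoxT` (computation), D2a
`SterileSmallCarrierT` (explicit construction), and the kernel-analysis stub **`SterileSmallCarrierT → SterileMechanismDoorT`**
— THIS FILE PROVES THE LATTER with both `Prop`s unfolded verbatim (crux workfiles are not importable). LABEL: E–C typing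
(KERNEL: theorems only; `--supports` stmt-NavierStokesRegularity-20303). WHAT THIS IS NOT: not Navier–Stokes evidence — no
carrier, run, stage or design is exhibited; the conclusion `NoSwirlRungAtOneT` appears only under the two hypotheses
(a sterile small carrier of every `L³` size, and ONE sterile `W` with a free run meeting the door box).

## Proof (the door of record `Germ.mechanismDoorAt_of_boxNumerics`, re-walked inside the swirl-free stratum)

`η ≤ Y₁/3` (`Germ.margin_le_third_at`); a sterile strict-slot carrier `U₁` with `‖U₁‖_{L³} ≤ c` (the hypothesis at
`δ = c`, `c` the constant of `exists_classical_run_norm_le_two_mul_Icc`) has a classical free run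
on `[1, τfirstAt tuned]` below `2Y₀ ≤ (5/3)Y₁ − η` (`TowerRates.tuned_sep`); the SUPERPOSITION DOOR
`Germ.LevelZeroDataAt.exists_superposed_freeRun` admits EVERY translation `c` with `‖c‖ ≥ r₀` — take `c = max r₀ 0 • e₃`
ON THE AXIS, so `U₁ + W(· − c)` is axisymmetric swirl-free (`isAxisymmetric_add`, `isAxisymmetric_sub_onAxis`, …); its
germ schedule has datum `0` and a sterile force (`Germ.LineGermDataAt.schedule_axisym_noSwirl`, from the isometry covariance
of the germ host, p556418), and the free-run door with the schedule exposed (`Germ.LevelZeroDataAt.exists_lineGerm_stageOne_of_freeRun`,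
p556882) supplies the registered level-`1` stage: `NoSwirlRungAtOneT`. With T1′ this is the mirror decider in the door box:
`EpisodeBaseT ∧ ¬(HeredityAtOneT ∧ HeredityFromTwoT)` (K201), the composition being the strategist's sorry-free
`door_mirror_decides`; what remains OPEN on that line is D2a (a sterile strict-slot carrier: a POLOIDAL pusher in place of the
azimuthal `faintPusher`) and T1′ (the STERILE-DOOR computation).

References: S. Palasek, arXiv:2605.13827 §4 [cite: Palasek2026ElementaryModel, §4]; T. Kato, Math. Z. 187 (1984) Thm. 2–4
[cite: Kato1984, Thm. 2–4]; P. G. Lemarié-Rieusset (2016) Thm 10.4 [cite: LemarieRieusset2016, Thm 10.4 (p. 285)].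
-/

noncomputable section

-- `Summit.<Summit>.<Problem>` is the tree's mandated summit-side namespace (CONVENTIONS §2); for this
-- single-conjunct summit the two coincide, so the duplicate is deliberate.
set_option linter.dupNamespace false

namespace Summit.NavierStokesRegularity.NavierStokesRegularity.Theorems

open Set Function MeasureTheory Metric
open scoped ENNReal ContDiff RealInnerProductSpace
open Summit.NavierStokesRegularity.NavierStokesRegularity.Theses
open Summit.NavierStokesRegularity.FluidComputer.PalasekTowerClayBridge
open Summit.NavierStokesRegularity.FluidComputer.PalasekTowerClayBridge.Germ
open Summit.NavierStokesRegularity.HeredityFromTwoTNoSwirl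
open Literature.Analysis Literature.Analysis.FluidPDE

/-! ## §1 Sums and on-axis translates of axisymmetric swirl-free fields -/

/-- The sum of two axisymmetric fields is axisymmetric. [cite: MajdaBertozziCUP2002, §2.3.3 (2.52)–(2.53)] -/
theorem isAxisymmetric_add {u w : EuclideanSpace ℝ (Fin 3) → EuclideanSpace ℝ (Fin 3)} (hu : IsAxisymmetric u)
    (hw : IsAxisymmetric w) : IsAxisymmetric (u + w) := by
  intro θ x
  rw [Pi.add_apply, Pi.add_apply, hu θ x, hw θ x, ← rotZLIE_apply, ← rotZLIE_apply, ← rotZLIE_apply, map_add]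

/-- The sum of two swirl-free fields is swirl-free. [cite: MajdaBertozziCUP2002, §2.3.3 (2.52)–(2.53)] -/
theorem hasNoSwirl_add {u w : EuclideanSpace ℝ (Fin 3) → EuclideanSpace ℝ (Fin 3)} (hu : HasNoSwirl u)
    (hw : HasNoSwirl w) : HasNoSwirl (u + w) := by
  intro x
  have h1 := hu x
  have h2 := hw x
  unfold swirl at h1 h2 ⊢
  simp only [Pi.add_apply, PiLp.add_apply]
  linear_combination h1 + h2

/-- The translate `x ↦ w (x − c)` of an axisymmetric field along the axis (`c 0 = c 1 = 0`) is axisymmetric.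
[cite: MajdaBertozziCUP2002, §2.3.3 (2.52)–(2.53)] -/
theorem isAxisymmetric_sub_onAxis {w : EuclideanSpace ℝ (Fin 3) → EuclideanSpace ℝ (Fin 3)} (hw : IsAxisymmetric w)
    {c : EuclideanSpace ℝ (Fin 3)} (hc0 : c 0 = 0) (hc1 : c 1 = 0) : IsAxisymmetric (fun x => w (x - c)) := by
  intro θ x
  show w (rotZ θ x - c) = rotZ θ (w (x - c))
  rw [show rotZ θ x - c = rotZ θ (x - c) by
    rw [← rotZLIE_apply, ← rotZLIE_apply, map_sub, rotZLIE_apply θ c, rotZ_of_onAxis hc0 hc1], hw θ]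

/-- The translate of a swirl-free field along the axis is swirl-free. [cite: MajdaBertozziCUP2002, §2.3.3 (2.52)–(2.53)] -/
theorem hasNoSwirl_sub_onAxis {w : EuclideanSpace ℝ (Fin 3) → EuclideanSpace ℝ (Fin 3)} (hw : HasNoSwirl w)
    {c : EuclideanSpace ℝ (Fin 3)} (hc0 : c 0 = 0) (hc1 : c 1 = 0) : HasNoSwirl (fun x => w (x - c)) := by
  intro x
  have h := hw (x - c)
  have e0 : (x - c) 0 = x 0 := by simp [hc0]
  have e1 : (x - c) 1 = x 1 := by simp [hc1]
  unfold swirl at h ⊢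
  rw [e0, e1] at h
  exact h

/-- The on-axis point `r • e₃`: its horizontal coordinates vanish and its norm is `|r|`. [folklore] -/
theorem axisPoint_spec (r : ℝ) :
    (r • EuclideanSpace.single (2 : Fin 3) (1 : ℝ)) 0 = 0 ∧ (r • EuclideanSpace.single (2 : Fin 3) (1 : ℝ)) 1 = 0 ∧
      ‖r • EuclideanSpace.single (2 : Fin 3) (1 : ℝ)‖ = |r| := by
  refine ⟨by simp, by simp, ?_⟩
  have h1 : ‖EuclideanSpace.single (2 : Fin 3) (1 : ℝ)‖ = 1 := by
    rw [EuclideanSpace.norm_eq]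
    simp
  rw [norm_smul, h1, mul_one, Real.norm_eq_abs]

/-! ## §2 The stub `SterileSmallCarrierT → SterileMechanismDoorT`, by its unfolded text -/

/-- **STERILE SMALL CARRIERS ⟹ THE STERILE MECHANISM DOOR AT `tuned`** (the strategist's
`stub_sterile_door_of_small_carrierT` by its unfolded text). Hypothesis = `SterileSmallCarrierT`: for every `δ > 0` an
axisymmetric swirl-free strict-slot profile at `tuned` inside radius `7` with `‖U‖_{L³} ≤ δ`. Conclusion =
`SterileMechanismDoorT`: for every axisymmetric swirl-free smooth divergence-free `W` with `tsupport W ⊆ B̄(0, ρ)`, speed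
`< Y₀`, and ONE classical finite-energy FREE run on `[1, τfirstAt tuned]` from `W` under `(5/3)Y₁ − η` showing the three
level-`1` faces with margin `η > 0` in `‖x‖ ≤ ρ` — `NoSwirlRungAtOneT`. [cite: Palasek2026ElementaryModel, §4]
[cite: Kato1984, Thm. 2–4] -/
theorem palasekTowerBreakdown_sterileMechanismDoorT_of_sterileSmallCarrierT
    (hcar : ∀ δ : ℝ, 0 < δ →
      ∃ U : EuclideanSpace ℝ (Fin 3) → EuclideanSpace ℝ (Fin 3),
        IsAxisymmetric U ∧ HasNoSwirl U ∧ LevelZeroDataAt TowerRates.tuned U 7 ∧ (eLpNorm U 3 volume).toReal ≤ δ) :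
    ∀ ⦃W : EuclideanSpace ℝ (Fin 3) → EuclideanSpace ℝ (Fin 3)⦄ ⦃ρ : ℝ⦄,
    IsAxisymmetric W → HasNoSwirl W →
    ContDiff ℝ ∞ W → VectorCalculus.IsDivFree W → tsupport W ⊆ closedBall 0 ρ →
    (∀ x, ‖W x‖ < TowerRates.tuned.Y 0) → 0 ≤ ρ →
    ∀ ⦃v : ℝ → EuclideanSpace ℝ (Fin 3) → EuclideanSpace ℝ (Fin 3)⦄ ⦃q : ℝ → EuclideanSpace ℝ (Fin 3) → ℝ⦄,
      IsClassicalNSSolutionOn (Icc 1 (Host.τfirstAt TowerRates.tuned)) 1 0 v q → v 1 = W →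
      (∃ C : ℝ≥0∞, C < ⊤ ∧ ∀ t ∈ Icc (1 : ℝ) (Host.τfirstAt TowerRates.tuned), ∫⁻ x, ‖v t x‖ₑ ^ 2 ≤ C) →
      ∀ ⦃η : ℝ⦄, 0 < η →
        (∀ t ∈ Icc (1 : ℝ) (Host.τfirstAt TowerRates.tuned), ∀ x, ‖v t x‖ ≤ 5 / 3 * TowerRates.tuned.Y 1 - η) →
        (∃ x, ‖x‖ ≤ ρ ∧ TowerRates.tuned.Y 1 + η ≤ ‖v (Host.τfirstAt TowerRates.tuned) x‖) →
        (∃ x, ‖x‖ ≤ ρ ∧ TowerRates.tuned.A 1 + η ≤ ‖fderiv ℝ (v (Host.τfirstAt TowerRates.tuned)) x‖) →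
        (∃ (x : EuclideanSpace ℝ (Fin 3)) (γ : ℝ → EuclideanSpace ℝ (Fin 3)),
          ‖x‖ ≤ ρ ∧ ContDiff ℝ 1 γ ∧ γ 0 = γ 1 ∧
          (∀ s ∈ Icc (0 : ℝ) 1, γ s ∈ closedBall x (1 / TowerRates.tuned.N 1)) ∧
          (∀ s ∈ Icc (0 : ℝ) 1, ‖deriv γ s‖ ≤ 8 * Real.pi / TowerRates.tuned.N 1) ∧
          TowerRates.tuned.N 1 ^ (TowerRates.tuned.β - 2) + η ≤ circulation (v (Host.τfirstAt TowerRates.tuned)) γ) →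
        NoSwirlRungAtOneT := by
  intro W ρ hax hsw hW hdivW hWsupp hWlt hρ v q hv hv1 hvE η hη hcap hspeed hstrain hcore
  set R := TowerRates.tuned with hRdef
  have hR : R.BoxNumerics 128 (1 / 3) := TowerRates.tuned_boxNumerics
  have hτ : Host.τfirstAt R ∈ Icc (1 : ℝ) (Host.τfirstAt R) := ⟨(Host.one_lt_τfirstAt R).le, le_rfl⟩
  have hη3 : η ≤ R.Y 1 / 3 := margin_le_third_at hspeed (hcap (Host.τfirstAt R) hτ)
  have hsep : 2 * R.Y 0 ≤ R.Y 1 := by simpa using TowerRates.tuned_sep 0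
  -- a sterile strict-slot carrier, `L³`-small, and its free run under the cap
  obtain ⟨c, hc, hrun⟩ := exists_classical_run_norm_le_two_mul_Icc
  obtain ⟨U₁, hax₁, hsw₁, hLZ, hL3⟩ := hcar (c * 1) (by rw [mul_one]; exact hc)
  obtain ⟨v₁, q₁, hv₁, hv₁1, hv₁E, hbd⟩ := hrun one_pos (Host.one_lt_τfirstAt R) hLZ.smooth hLZ.confined.2 hLZ.divFree
    (R.Y_pos 0) hLZ.ceiling hL3
  have hcap₁ : ∀ t ∈ Icc (1 : ℝ) (Host.τfirstAt R), ∀ x, ‖v₁ t x‖ ≤ 5 / 3 * R.Y 1 - η := fun t ht x =>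
    (hbd t ht x).trans (by linarith)
  -- the superposition door: every far translate is admissible; take it ON THE AXIS
  obtain ⟨r₀, hr₀⟩ := hLZ.exists_superposed_freeRun hW hdivW hWsupp hWlt hρ hv₁ hv₁1 hv₁E hv hv1 hvE hη hcap₁ hcap
    hspeed hstrain hcore
  set cvec : EuclideanSpace ℝ (Fin 3) := (max r₀ 0) • EuclideanSpace.single (2 : Fin 3) (1 : ℝ) with hcvec
  obtain ⟨hc0, hc1, hcnorm⟩ := axisPoint_spec (max r₀ 0)
  have hr : r₀ ≤ ‖cvec‖ := by
    rw [hcvec, hcnorm, abs_of_nonneg (le_max_right _ _)]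
    exact le_max_left _ _
  obtain ⟨hLZ', u, p, hu, hu1, huE, hucap, husp, hust, huco⟩ := hr₀ cvec hr
  -- the composite is axisymmetric swirl-free
  have hax' : IsAxisymmetric (U₁ + fun x => W (x - cvec)) := isAxisymmetric_add hax₁ (isAxisymmetric_sub_onAxis hax hc0 hc1)
  have hsw' : HasNoSwirl (U₁ + fun x => W (x - cvec)) := hasNoSwirl_add hsw₁ (hasNoSwirl_sub_onAxis hsw hc0 hc1)
  -- the companion-free germ line of the composite, schedule exposed, and its sterility
  obtain ⟨σ₀, ε, d, ⟨s⟩⟩ := hLZ'.exists_lineGerm_stageOne_of_freeRun hR hu hu1 huE (half_pos hη) hucap husp hust huco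
  obtain ⟨hrig, hqu, hpins, -⟩ := d.schedule_facts hR
  exact ⟨d.schedule hR, hpins, hrig, hqu, d.schedule_axisym_noSwirl hR hax' hsw', ⟨s⟩⟩

end Summit.NavierStokesRegularity.NavierStokesRegularity.Theorems

end
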